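import Summits.Ventures.PercRepro.S2FourteenSixSpread

/-!
# PercRepro — S2: THE COLOOP-FREE CELL `(14, 6)` (p7, gen 14; sub-claim S2; the `p = 14` row)

The coloop-free cell `(14, 6)` at `K = 12417` (`Φ(14, 5) ≤ 2^19/K`): the cases `ν = 5` (a set of nullity `5` on `≤ 10` points:
`#U ≤ 5082`, `#spanning ≤ 7228`, slack `81/1024`) and `ν = 4` (`14532` / `18748` / `93`) by the concentrated tail
(`S2.topCount_le_sum_spanning`, `S2.ncard_spanning_le_of_nullity`), the SPREAD case by the hitting lever
(S2FourteenSixSpread). The caps `10 / 35 / 156` and the tail lemma are those of the scaled cell (S2FifteenSixScaled).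
**`ThmN.c025_fourteen_six_cf`**. Axioms: standard.
-/

open scoped Matroid

namespace PercRepro

namespace ThmN

open Set

variable {α : Type}

/-- **The coloop-free cell `(14, 6)`**: `RLS M 14 5` on every coloop-free `e`-free core of rank `14` on `20` points. -/
theorem c025_fourteen_six_cf (M : Matroid α) [M.Finite]
    (hR : M.eRank = ((14 : ℕ) : ℕ∞)) (hn : M.E.ncard = 14 + 6)
    (hfree : ∀ e ∈ M.E, ∃ A ⊆ M.E \ {e}, e ∉ M.closure A ∧ e ∉ M.closure ((M.E \ {e}) \ A)) (hK : ∀ e, ¬ M.IsColoop e) :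
    RLS M 14 5 := by
  classical
  have hd : M.E.encard = M.eRank + ((6 : ℕ) : ℕ∞) := by
    rw [hR, ← M.ground_finite.cast_ncard_eq, hn]
    push_cast
    ring
  obtain ⟨hs3, hs4, hs5⟩ := caps_fourteen_six_scaled_cf M hd hn hfree hK
  have full : ∀ (k : ℕ) {W : Set α}, W ⊆ M.E → W.encard = M.eRk W + k →
      Matroid.topCount M 14 5 ≤ ∑ m ∈ Finset.Icc 5 6, ∑ j ∈ Finset.Icc (m + k - 6) m,
        W.ncard.choose j * (14 + 6 - W.ncard).choose (m - j) := by
    intro k W hW hWk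
    refine (S2.topCount_le_sum_spanning M hR hd 5).trans ?_
    refine Finset.sum_le_sum (fun m _ => ?_)
    have h := S2.ncard_spanning_compl_le_of_nullity M hW hd hWk (m := m)
    rw [hn] at h
    exact h
  have span : ∀ (k : ℕ) {W : Set α}, W ⊆ M.E → W.encard = M.eRk W + k →
      {X : Set α | X ⊆ M.E ∧ M.eRk X = M.eRank}.ncard ≤ ∑ m ∈ Finset.range (6 + 1), ∑ j ∈ Finset.Icc (m + k - 6) m,
        W.ncard.choose j * (14 + 6 - W.ncard).choose (m - j) := by
    intro k W hW hWk
    have h := S2.ncard_spanning_le_of_nullity M hW hd hWk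
    rw [hn] at h
    exact h
  have cell : ∀ (U S m : ℕ), Matroid.topCount M 14 5 ≤ U → {X : Set α | X ⊆ M.E ∧ M.eRk X = M.eRank}.ncard ≤ S → m ≤ 1024 →
      1024 * (U : ℚ) ≤ ((1024 - m : ℕ) : ℚ) * 2 ^ (6 - 5) * (12417 : ℚ) →
      (1024 : ℚ) * ((159939887 / 2115 : ℚ) + (S : ℚ)) ≤ (m : ℚ) * 2 ^ 20 → RLS M 14 5 := by
    intro U S m hU hS hm hpoly htail
    rw [RLS_iff]
    exact c025_core_five_cell_of_topCount_spanning_xqictq5g M 14 6 (by norm_num) hR hn hfree 10 35 156 hs3 hs4 hs5 U hU S hS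
      12417 (by norm_num) (phiK 14 5) (by rw [S2.phiK_fourteen_five]; norm_num) ⟨m, hm, hpoly, tail_fourteen_six_scaled_cf S m htail⟩
  by_cases h5 : ∃ W ⊆ M.E, W.ncard ≤ 10 ∧ W.encard = M.eRk W + 5
  · obtain ⟨W, hW, hWn, hWk⟩ := h5
    have hU' : Matroid.topCount M 14 5 ≤ 5082 := by
      refine (full 5 hW hWk).trans ?_
      generalize W.ncard = w at hWn ⊢
      interval_cases w <;> decide
    have hS' : {X : Set α | X ⊆ M.E ∧ M.eRk X = M.eRank}.ncard ≤ 7228 := by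
      refine (span 5 hW hWk).trans ?_
      generalize W.ncard = w at hWn ⊢
      interval_cases w <;> decide
    exact cell 5082 7228 81 hU' hS' (by norm_num) (by norm_num) (by norm_num)
  by_cases h4 : ∃ W ⊆ M.E, W.ncard ≤ 9 ∧ W.encard = M.eRk W + 4
  · obtain ⟨W, hW, hWn, hWk⟩ := h4
    have hU' : Matroid.topCount M 14 5 ≤ 14532 := by
      refine (full 4 hW hWk).trans ?_
      generalize W.ncard = w at hWn ⊢
      interval_cases w <;> decide
    have hS' : {X : Set α | X ⊆ M.E ∧ M.eRk X = M.eRank}.ncard ≤ 18748 := by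
      refine (span 4 hW hWk).trans ?_
      generalize W.ncard = w at hWn ⊢
      interval_cases w <;> decide
    exact cell 14532 18748 93 hU' hS' (by norm_num) (by norm_num) (by norm_num)
  · exact c025_fourteen_six_cf_spread M hR hn hfree hK h4

end ThmN

end PercRepro
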